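import Literature.NumberTheory.EllipticCurves.ZpExtensionEisensteinDVRSettingSatisfiesHOfLiftsProofs
import Literature.NumberTheory.EllipticCurves.ZpExtensionEisensteinDVRSettingDualityDataUnitTwistProofs
import Literature.NumberTheory.EllipticCurves.ZpExtensionEisensteinConjugationDatumProofs
import Summits.BirchSwinnertonDyer.BirchSwinnertonDyer.Theorems.PrintX9MuPartHowardH2OfPrint
import HarnessLib

/-!
# The SETTING-DATA half of STUB A of the shared μ-crux on its frames: conjugation datum, H.4 data and `SatisfiesH`
# for the levels-tame Eisenstein setting of `E_K`, packaged (D1 assembly)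

Cell `pub/bsd-print-x9`, LEAD `bsd-line-x10b-p1` (g8), D1 road; `--supports` the shared μ-crux stmt-BirchSwinnertonDyer-22642
(`MuInequalityCoherentPair`, skeleton v3/v4 STUB A `stub_howardInputs`: «`∃ … cd Dd fs … (hy : St.SatisfiesH) …`»).
THEOREMS ONLY; nothing here asserts the μ-item.  No summit statement is proved; BSD is not proved by any of this.

On the frames of the letter (`CastellaGrossiLeeSkinner2022.Thm413Hypotheses N W K p κ γ` + `(irr_ℚ)` + `(irr_K)`), for the
tower at any unit twist `κ.unitTwist u` (the crux's `κ⁻ = κ.unitTwist (-1)`), any `m ≥ 1`, any tame pins `π`, any finite set of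
places `S ⊇ {v ∣ p} ∪ {bad}` stable under `Aut(K/ℚ)` (x9-p1-w2's `exists_sigmaStable_badFinset`), any admissible prime set `𝓛`
off `S` and any `jbar`, THERE ARE: a complex conjugation `c₀ ∈ Γ_ℚ`, the non-trivial involution `σ` of `K` lifted by the
involution `e c₀ e⁻¹` of `K̄` (`exists_conjugationDatum_ofLifts_τ_eq_absGaloisTransport`, p655735) — whence the CANONICAL
conjugation datum `cd := ConjugationDatum.ofLifts σ …` with `cd.τ = e c₀ e⁻¹` —, H.4 data `D k` on the levels `T^{(k)}` built from
a Weil family `e_j` and a discrete logarithm `log_j` (`exists_eisensteinDualityData_unitTwist`, p656419 + sequel) with all their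
exported identities, SUCH THAT Howard's `SatisfiesH` holds for
`St := W.eisensteinDVRSettingLevelsTame (κ.unitTwist u) hm π S hpS hbad L hL hLS jbar cd D` AS SOON AS the local clauses of
H.4 and H.5(b) at the finitely many places `v ∈ S` hold for THIS `D` (`hfin4`, `hfin5b`) — given the tree's Poitou–Tate named
fact `poitouTate_selmerStructure_duality K` (binder `hPT`):
* **`exists_eisensteinSettingData_satisfiesH_of_thm413Hypotheses`** — the `obtain` chain of D1's STUB-A recipe §1–§5 in one
  theorem (`eisensteinDVRSettingLevelsTame_satisfiesH_of_ofLifts` fed with `exists_smul_eq_zsmul_of_thm413Hypotheses` for H.2,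
  `Thm413Hypotheses.exists_forall_eq_zsmul_of_hasIrreducibleModPGaloisRep` for Schur, `hyp.p_ne_two`, `hyp.isImaginaryQuadratic`,
  `hyp.anticyclotomic`).
What it does NOT supply: the clauses at `v ∈ S` (H.4: `v ∣ p` ordinary isotropy/duality, `v ∣ N` uniform local bounds; H.5(b):
`τ` transports `F_𝔮` at `σ•v` to `v`), `LargePrimes` (separately: `eisensteinDVRSetting_largePrimes`), the Kolyvagin system and the
LINK.  HONEST FRAMING: conditional on `poitouTate_selmerStructure_duality K`.

References: B. Howard, Compositio Math. 140 (2004), §1.3 H.0–H.5, §1.6 (arXiv:1202.6340 p. 7–8, p. 11); Castella–Grossi–Lee–Skinner,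
Invent. Math. 227 (2022), §3.2; J. S. Milne, *Arithmetic Duality Theorems* (2006), I Thm. 2.6, 4.10.
-/

set_option autoImplicit false
-- the summit and its single problem are both named `BirchSwinnertonDyer` (registry layout D-0017)
set_option linter.dupNamespace false

noncomputable section

open Function NumberField IsDedekindDomain Field
open scoped NumberField ContRepresentation TensorProduct Classical
open Literature.NumberTheory.EllipticCurves Literature.NumberTheory.GaloisRepresentations
open Literature.NumberTheory.GaloisRepresentations.DiscreteGaloisModule
open Literature.NumberTheory.GaloisCohomology Literature.NumberTheory.GaloisCohomology.Howard2004
open Literature.NumberTheory.EllipticCurves.ZpExtension (EisensteinLevel)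
open WeierstrassCurve (geomTorsion)

namespace Summit.BirchSwinnertonDyer.BirchSwinnertonDyer.Theorems.HeegnerMuPartHowardSetting

variable {N : ℕ} {W : WeierstrassCurve ℚ} [W.IsGloballyMinimal] {K : Type} [Field K] [NumberField K]
  {p : ℕ} [hp : Fact p.Prime] {κ : ZpExtension K p} {γ : absoluteGaloisGroup K}

set_option synthInstance.maxHeartbeats 80000 in
set_option maxHeartbeats 800000 in
/-- **The setting-data half of STUB A on the frames of the shared μ-letter.**  Under `Thm413Hypotheses N W K p κ γ`, `(irr_ℚ)`,
`(irr_K)` and the Poitou–Tate named fact, for the Eisenstein tower at `κ.unitTwist u`, `m ≥ 1`, pins `π`, an `Aut(K/ℚ)`-stable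
`S ⊇ {v ∣ p} ∪ {bad}`, `𝓛` admissible off `S`, `jbar`: there are `c₀` (complex conjugation in `Γ_ℚ`), `σ ≠ 1`, `σ² = 1` lifted by
the involution `e c₀ e⁻¹`, H.4 data `D` from a Weil family `e` and a logarithm `log` — with `cd.τ = e c₀ e⁻¹`,
`(D k).e = eisensteinDualityForm … (conjPairing (e (k+1)) τ_* (log (k+1)))`, `e` alternating / `Γ_K`-equivariant / `τ`-anti-invariant,
`τ_*` involutive, `log` bijective and `χ̄`-equivariant — such that `SatisfiesH` of the levels-tame setting with the canonical
conjugation datum holds once the H.4 / H.5(b) clauses at the places `v ∈ S` hold for this `D`.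
[cite: Howard2004HeegnerKolyvagin, §1.3 H.0–H.5 and §1.6 (arXiv p. 7 L33 – p. 8 L1, p. 11 L13–38)]
[cite: CastellaGrossiLeeSkinner2022, §3.2 standing hypotheses] [cite: MilneADT2006, Ch. I, Thm. 2.6 and Thm. 4.10(b)] -/
theorem exists_eisensteinSettingData_satisfiesH_of_thm413Hypotheses
    (hyp : CastellaGrossiLeeSkinner2022.Thm413Hypotheses N W K p κ γ) (hirr : W.HasIrreducibleModPGaloisRep p)
    (hirrK : (W.baseChange K).HasIrreducibleModPGaloisRep p)
    (hPT : poitouTate_selmerStructure_duality K)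
    (u : ℤ_[p]ˣ) {m : ℕ} (hm : 1 ≤ m) (π : ∀ v : HeightOneSpectrum (𝓞 K), TamePin v)
    (S : Finset (HeightOneSpectrum (𝓞 K)))
    (hpS : ∀ v : HeightOneSpectrum (𝓞 K), ((p : ℕ) : 𝓞 K) ∈ v.asIdeal → v ∈ S)
    (hbad : haveI := hyp.isElliptic
      ∀ v : HeightOneSpectrum (𝓞 K), v ∉ S → ((p : ℕ) : 𝓞 K) ∉ v.asIdeal → (W.baseChange K).HasGoodReductionAt v)
    (hSσ : ∀ (σ : K ≃ₐ[ℚ] K) (v : HeightOneSpectrum (𝓞 K)), σ • v ∈ S → v ∈ S)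
    (L : Set (HeightOneSpectrum (𝓞 K)))
    (hL : haveI := hyp.isElliptic
      letI := IwasawaAlgebra.isLocalRing_quotient_X_pow_add_C p hm
      L ⊆ (W.eisensteinTower (κ.unitTwist u) hm).degreeTwoPrimes p)
    (hLS : ∀ v ∈ L, v ∉ S) (jbar : AlgebraicClosure K →+* ℂ) :
    haveI := hyp.isElliptic
    letI := IwasawaAlgebra.isDomain_quotient_X_pow_add_C p hm
    letI := IwasawaAlgebra.isDiscreteValuationRing_quotient_X_pow_add_C p hm
    haveI := IwasawaAlgebra.EisensteinCoeff.isLocalRing_succ p hm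
    letI := IwasawaAlgebra.EisensteinCoeff.algebraOfSpecSucc p m
    haveI := W.isScalarTower_algebraOfSpecSucc (K := K) (p := p) (m := m)
    letI := W.residueModuleSucc (K := K) (p := p) hm
    ∃ (c₀ : absoluteGaloisGroup ℚ) (σ : K ≃ₐ[ℚ] K) (hσ₁ : σ ≠ 1) (hσ : σ * σ = 1)
      (hτl : IsLiftOfAut σ (absGaloisTransport (K := ℚ) (L := K) c₀).toRingEquiv)
      (hτ₂ : Function.Involutive (absGaloisTransport (K := ℚ) (L := K) c₀).toRingEquiv)
      (D : ∀ k, DualityDatum p (ConjugationDatum.ofLifts σ hσ₁ hσ _ hτl hτ₂) ((W.eisensteinTower (κ.unitTwist u) hm).ρ k)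
        (IwasawaAlgebra.EisensteinCoeff p m (k + 1)))
      (e : ∀ j : ℕ, geomTorsion (W.baseChange K) ((p : ℤ) ^ j) →+ geomTorsion (W.baseChange K) ((p : ℤ) ^ j) →+
        MuCarrier K (p ^ j))
      (log : ∀ j : ℕ, MuCarrier K (p ^ j) →+ ZMod (p ^ j)),
      IsComplexConjugation (Rat.castHom ℝ) c₀ ∧
      (∀ x, (ConjugationDatum.ofLifts σ hσ₁ hσ _ hτl hτ₂).τ x = absGaloisTransport (K := ℚ) (L := K) c₀ x) ∧
      (∀ k, (D k).e = ZpExtension.eisensteinDualityForm hm (k + 1)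
        (conjPairing (e (k + 1)) ((ConjugationDatum.ofLifts σ hσ₁ hσ _ hτl hτ₂).isLift.torsionMap W _) (log (k + 1)))) ∧
      (∀ j a, e j a a = 0) ∧
      (∀ j (g : absoluteGaloisGroup K) a b, e j (g • a) (g • b) = mu K (p ^ j) g (e j a b)) ∧
      (∀ j a b, e j ((ConjugationDatum.ofLifts σ hσ₁ hσ _ hτl hτ₂).isLift.torsionMap W _ a)
        ((ConjugationDatum.ofLifts σ hσ₁ hσ _ hτl hτ₂).isLift.torsionMap W _ b) = -e j a b) ∧
      (∀ j (a : geomTorsion (W.baseChange K) ((p : ℤ) ^ j)),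
        (ConjugationDatum.ofLifts σ hσ₁ hσ _ hτl hτ₂).isLift.torsionMap W _
          ((ConjugationDatum.ofLifts σ hσ₁ hσ _ hτl hτ₂).isLift.torsionMap W _ a) = a) ∧
      (∀ j, Function.Bijective (log j)) ∧
      (∀ j (g : absoluteGaloisGroup K) ξ, log j (mu K (p ^ j) g ξ) = cyclotomicCharacterModPow K p j g * log j ξ) ∧
      ((letI := IwasawaAlgebra.isLocalRing_quotient_X_pow_add_C p hm
        ∀ k, ∀ v ∈ S, (D k).IsSelfOrthogonalAt
          (W.eisensteinTowerTriple (κ.unitTwist u) hm S hpS hbad L hL hLS k).cond v) →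
       (∀ k, ∀ v ∈ S,
        (((W.isQuotientBy_eisensteinDVRSetting_πbar (κ.unitTwist u) hm S hpS hbad L hL hLS jbar
            (ConjugationDatum.ofLifts σ hσ₁ hσ _ hτl hτ₂) D
            (W.eisensteinLevelsTameFs (κ.unitTwist u) hm π S hpS hbad L hL hLS)
            k).propagateStructure (W.eisensteinTowerTriple (κ.unitTwist u) hm S hpS hbad L hL hLS k).cond)
            (Sum.inr (σ • v))).map
            (((W.residualTauGeomTorsion (p := p) (ConjugationDatum.ofLifts σ hσ₁ hσ _ hτl hτ₂) hm (k := k + 1)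
                k.succ_pos).thetaH1 (Sum.inr v)).comp
              ((ConjugationDatum.ofLifts σ hσ₁ hσ _ hτl hτ₂).transportH1
                ((W.baseChange K).torsionGaloisModule (p : ℤ)) v)) =
          ((W.isQuotientBy_eisensteinDVRSetting_πbar (κ.unitTwist u) hm S hpS hbad L hL hLS jbar
            (ConjugationDatum.ofLifts σ hσ₁ hσ _ hτl hτ₂) D
            (W.eisensteinLevelsTameFs (κ.unitTwist u) hm π S hpS hbad L hL hLS)
            k).propagateStructure (W.eisensteinTowerTriple (κ.unitTwist u) hm S hpS hbad L hL hLS k).cond)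
            (Sum.inr v)) →
       (W.eisensteinDVRSettingLevelsTame (κ.unitTwist u) hm π S hpS hbad L hL hLS jbar
          (ConjugationDatum.ofLifts σ hσ₁ hσ _ hτl hτ₂) D).SatisfiesH) := by
  haveI := hyp.isElliptic
  letI := IwasawaAlgebra.isDomain_quotient_X_pow_add_C p hm
  letI := IwasawaAlgebra.isDiscreteValuationRing_quotient_X_pow_add_C p hm
  haveI := IwasawaAlgebra.EisensteinCoeff.isLocalRing_succ p hm
  letI := IwasawaAlgebra.EisensteinCoeff.algebraOfSpecSucc p m
  haveI := W.isScalarTower_algebraOfSpecSucc (K := K) (p := p) (m := m)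
  letI := W.residueModuleSucc (K := K) (p := p) hm
  have hK : IsImaginaryQuadratic K := hyp.isImaginaryQuadratic
  haveI : IsTotallyComplex K := hK.isTotallyComplex
  have himag : ∀ w : NumberField.InfinitePlace K, w.IsComplex := fun w ↦ IsTotallyComplex.isComplex w
  -- §1 frame: a complex conjugation of `ℚ̄` and the homothety of H.2
  obtain ⟨c₀, hc₀⟩ := exists_isComplexConjugation (Rat.castHom ℝ)
  obtain ⟨z, a, ha, hz⟩ := HeegnerMuPartHowardH2.exists_smul_eq_zsmul_of_thm413Hypotheses hyp hirr
  -- §2 the canonical conjugation datum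
  obtain ⟨σ, hσ₁, hσ, hτl, hτ₂, -, hτ⟩ := exists_conjugationDatum_ofLifts_τ_eq_absGaloisTransport hK hc₀
  -- §4 the instantiated H.4 data
  obtain ⟨D, e, log, hDe, he_red, h5c, h4', h5', h6', h7', h8', h9'⟩ :=
    W.exists_eisensteinDualityData_unitTwist κ u hm S hpS hbad L hL hLS jbar
      (ConjugationDatum.ofLifts σ hσ₁ hσ _ hτl hτ₂) hyp.anticyclotomic himag hc₀ hτ
  refine ⟨c₀, σ, hσ₁, hσ, hτl, hτ₂, D, e, log, hc₀, hτ, hDe, h4', h5', h6', h7', h8', h9', fun hfin4 hfin5b ↦ ?_⟩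
  -- §5 `SatisfiesH`
  exact W.eisensteinDVRSettingLevelsTame_satisfiesH_of_ofLifts (κ.unitTwist u) hm π S hpS hbad L hL hLS jbar σ hσ₁ hσ _
    hτl hτ₂ D hyp.p_ne_two hK hirrK
    (fun φ hφ ↦ hyp.exists_forall_eq_zsmul_of_hasIrreducibleModPGaloisRep hirrK φ hφ)
    κ (κ.kerSubgroup_unitTwist u) hyp.anticyclotomic hz ha hc₀ hτ hPT (hSσ σ) he_red
    (h5c (W.eisensteinLevelsTameFs (κ.unitTwist u) hm π S hpS hbad L hL hLS)) hfin4 hfin5b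

end Summit.BirchSwinnertonDyer.BirchSwinnertonDyer.Theorems.HeegnerMuPartHowardSetting

end
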